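import Literature.MathematicalPhysics.KineticTheory.HardSphereEulerLevelEnergies
import Literature.MathematicalPhysics.KineticTheory.HardSphereEulerEnergyShell
import Literature.MathematicalPhysics.KineticTheory.HardSphereEulerClassicalUniqueness
import Literature.MathematicalPhysics.KineticTheory.HardSphereEulerSolutionGluing
import Literature.Analysis.FluidPDE.CompressibleEulerHomogeneousEnergyDefs
import Literature.Analysis.FunctionSpaces.TorusEnstrophyOrthogonality
import Literature.Analysis.FluidPDE.IsentropicEulerUniformLifespan
import HarnessLib

/-!
# The fixed-horizon a-priori stability estimate for the hard-sphere Euler family (layer 4 of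
# `hsEuler_continuousDependence`): the bootstrap

MathematicalPhysics/KineticTheory proof file (theorems only; no definitions, no named facts). LAYER 4
of the proof of the named fact `hsEuler_continuousDependence` (Kato 1975 Thm III for the family
`p_σ = ρθZ(ρσ³)` on `𝕋³` at `σ = 0`; assembly `hsEuler_continuousDependence_of_localTheory`,
`HardSphereEulerContinuousDependenceProofs.lean`, whose hypothesis `hstab` is the conclusion here):
for every ideal-gas reference solution `V₁` on `[0, T₁)`, every `0 < T' < T₁` and `ε > 0` there are
`k (= 3)`, `δ > 0`, `M > 0` such that for `0 < σ < δ` and smooth positive data `δ`-close in `C³`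
to `V₁(0)`, EVERY classical `σ`-solution `V` with these data on `[0, T)`, `T ≤ T'`, obeys uniform
state and `C¹` bounds and is `ε`-close to `V₁` pointwise.

The estimate is proved here from FOUR inputs, kept as hypotheses so that each is a separate
theorem of the tree (`HsEulerStability.stabilityEstimate_of_level0`):

* (L0) the `σ`-uniform LEVEL-0 relative-energy stability `hsEuler_twoEos_level0_stability`
  (`HardSphereEulerTwoEosStability.lean`): the difference `W = V - V₁` is `L²`-small, uniformly on
  `[0, T')`, as long as both solutions stay in a state box with bounded first derivatives;
* (4a) smallness interpolation on `𝕋³`: a smooth function small in `L²` and bounded in `H³` is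
  small in `C¹` (`Torus.smallness_interpolation_three`, FunctionSpaces);
* (4b) the `σ`-uniform homogeneous `H³` energy inequality in a state box
  (`hsEuler_uniformDerivEnergy`, `HardSphereEulerUniformDerivEnergy.lean`);
* (4c) the data bound `D₃ ≤ 200 B²` (`CompressibleEuler.derivLevelEnergy_three_le_of_pointwise`).

Proof (Majda 1984, Ch. 2, proof of Thm 2.2, in a form exploiting that the REFERENCE is `C^∞`, so
that no energy of derivatives of the DIFFERENCE is needed): the continuity principle
`HsEulerCalc.bootstrap_of_continuousOn` on the two quantities `S₀ = Σ sup |W|`,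
`S₁ = Σᵢ Σ sup |∂ᵢW|` (continuous in time, `shadow_sup_continuous`). Under the doubled bounds
`S₀ ≤ 2β₀ ≤ min(1, m₁/2)`, `S₁ ≤ 1` on `[0, t]` the `σ`-solution stays in the state box
`[M⋆⁻¹, M⋆]` of the reference (floor `m₁`, size `N`, `exists_reference_bounds`) with `C¹` size
`≤ N + 1`, so (4b)+(4c) bound its `H³` energy by `E⋆ = C_H e^{κT'} 200(N+1)²`, (L0) bounds
`∫|W|² ≤ δ₄` for `δ` small, and each scalar component of `W(s)` is `L²`-small and `H³`-bounded by
`2E⋆ + 2N²`, hence `C¹`-small by (4a): `S₀ ≤ 5ε₁ ≤ β₀`, `S₁ ≤ 15ε₁ ≤ 1/2` for `s < t`, and at `t`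
by continuity. The thresholds at `t = 0` hold by the `C³`-closeness of the data
(`torus_norm_iterPartialDeriv_le_of_lift_bound`).

## Mathlib / tree search

Tree: `HsEulerCalc.bootstrap_of_continuousOn` (`HardSphereEulerEnergyShell`),
`HsEulerStability.shadow_sup_continuous(_vec)`, `torus_norm_iterPartialDeriv_le_of_lift_bound`
(`HardSphereEulerLevelEnergies`), `HsEulerCalc.exists_pos_le_of_isSmoothSpaceTimeOn`
(`HardSphereEulerClassicalUniqueness`), `IsHardSphereEulerSolution.restrict`
(`HardSphereEulerSolutionGluing`), `CompressibleEuler.{wordEnergy_le_derivLevelEnergy,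
iterPartialDeriv_apply_coord, abs_apply_le_norm, norm_le_sum_abs, le_of_forall_lt_of_continuousOn}`,
`Torus.IsSmoothSpaceTimeOn.iterPartialDeriv`, `Torus.iterPartialDeriv_add`,
`Torus.partialDeriv_apply_coord`. Mathlib: `integral_mono`, `EuclideanSpace.real_norm_sq_eq`,
`List.ofFn_get`, `Fin.forall_fin_two`.

## References

* T. Kato, *The Cauchy problem for quasi-linear symmetric hyperbolic systems*, Arch. Rational
  Mech. Anal. 58 (1975) 181–205, Thm III. [`Kato1975`]
* A. Majda, *Compressible Fluid Flow and Systems of Conservation Laws in Several Space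
  Variables*, Appl. Math. Sci. 53, Springer 1984: Ch. 2, §2.1, Thms 2.1–2.2 (energy inequality +
  Grönwall + continuity argument). [`Majda1984`]
* C. M. Dafermos, *Hyperbolic Conservation Laws in Continuum Physics*, 2nd ed. (2005), Ch. V,
  Thms 5.1.1, 5.2.1. [`Dafermos2005`]
-/

noncomputable section

open Set Filter MeasureTheory
open scoped ContDiff ENNReal

namespace Literature.MathematicalPhysics.KineticTheory

namespace HsEulerStability

open HsEulerCalc Literature.Analysis.FunctionSpaces Literature.Analysis.FluidPDE
open Literature.Analysis.FluidPDE.CompressibleEuler (wordEnergy derivLevelEnergy wordEnergy_nonneg)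

/-! ## §1 Helpers: continuity principle read-out, word energies, reference bounds -/

section Helpers

/-- The three `L²` integrals of a word derivative are dominated by `D₃`. [folklore] -/
theorem integral_sq_iterPartialDeriv_le_derivLevelEnergy {ρ ϑ : ℝ → T3 → ℝ} {u : ℝ → T3 → V3}
    {l : List (Fin 3)} (h1 : 1 ≤ l.length) (h3 : l.length ≤ 3) (t : ℝ) :
    (∫ y, Torus.iterPartialDeriv l (ρ t) y ^ 2) ≤ derivLevelEnergy ρ u ϑ 3 t ∧
      (∀ k : Fin 3, (∫ y, Torus.iterPartialDeriv l (fun y => u t y k) y ^ 2) ≤ derivLevelEnergy ρ u ϑ 3 t) ∧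
      (∫ y, Torus.iterPartialDeriv l (ϑ t) y ^ 2) ≤ derivLevelEnergy ρ u ϑ 3 t := by
  have h := CompressibleEuler.wordEnergy_le_derivLevelEnergy (ρ := ρ) (u := u) (ϑ := ϑ) (m := 3) h1 h3 t
  unfold wordEnergy at h
  have hρ0 : 0 ≤ ∫ y, Torus.iterPartialDeriv l (ρ t) y ^ 2 := integral_nonneg fun y => sq_nonneg _
  have hϑ0 : 0 ≤ ∫ y, Torus.iterPartialDeriv l (ϑ t) y ^ 2 := integral_nonneg fun y => sq_nonneg _
  have hu0 : ∀ k, 0 ≤ ∫ y, Torus.iterPartialDeriv l (fun y => u t y k) y ^ 2 := fun k => integral_nonneg fun y => sq_nonneg _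
  have hus : 0 ≤ ∑ k, ∫ y, Torus.iterPartialDeriv l (fun y => u t y k) y ^ 2 := Finset.sum_nonneg fun k _ => hu0 k
  refine ⟨by linarith, fun k => ?_, by linarith⟩
  have hk := Finset.single_le_sum (f := fun k => ∫ y, Torus.iterPartialDeriv l (fun y => u t y k) y ^ 2)
    (fun k _ => hu0 k) (Finset.mem_univ k)
  linarith

/-- A finite family of jointly smooth fields on `[0, T) × 𝕋³` is bounded in norm on
`[0, t₁] × 𝕋³`, `t₁ < T`, by one constant `≥ 0`. [folklore] -/
theorem exists_forall_norm_le_on_slab {ι : Type*} [Fintype ι] {F : Type*}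
    [NormedAddCommGroup F] [NormedSpace ℝ F] {T t₁ : ℝ} {f : ι → ℝ → T3 → F}
    (hf : ∀ k, Torus.IsSmoothSpaceTimeOn (Ico 0 T) (f k)) (ht₁ : t₁ < T) :
    ∃ K, 0 ≤ K ∧ ∀ k, ∀ t ∈ Icc 0 t₁, ∀ x, ‖f k t x‖ ≤ K := by
  have hone : ∀ k, ∃ K, 0 ≤ K ∧ ∀ t ∈ Icc 0 t₁, ∀ x, ‖f k t x‖ ≤ K := fun k => by
    obtain ⟨K, hK⟩ := (hf k).exists_norm_le_of_isCompact isCompact_Icc (Icc_subset_Ico_right ht₁)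
    exact ⟨max K 0, le_max_right _ _, fun t ht x => (hK t ht x).trans (le_max_left _ _)⟩
  choose K hK0 hK using hone
  refine ⟨∑ k, K k, Finset.sum_nonneg fun k _ => hK0 k, fun k t ht x => ?_⟩
  exact (hK k t ht x).trans (Finset.single_le_sum (fun j _ => hK0 j) (Finset.mem_univ k))

/-- **Bounds of an ideal-gas reference solution on a compact sub-interval of its life span**: a
positive floor `m₁` of `ρ₁, θ₁` and one bound `N ≥ 1` of all iterated spatial partial derivatives
of orders `≤ 3` of `ρ₁, u₁, θ₁` on `[0, T'] × 𝕋³`, `T' < T₁`. [folklore] -/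
theorem exists_reference_bounds {T₁ T' : ℝ} {ρ₁ θ₁ : ℝ → T3 → ℝ} {u₁ : ℝ → T3 → V3}
    (hE : IsHardSphereEulerSolution 0 T₁ ρ₁ u₁ θ₁) (hT' : T' < T₁) :
    ∃ N m₁ : ℝ, 1 ≤ N ∧ 0 < m₁ ∧ ∀ t ∈ Icc 0 T', ∀ x, m₁ ≤ ρ₁ t x ∧ m₁ ≤ θ₁ t x ∧
      ∀ l : List (Fin 3), l.length ≤ 3 →
        |Torus.iterPartialDeriv l (ρ₁ t) x| ≤ N ∧ ‖Torus.iterPartialDeriv l (u₁ t) x‖ ≤ N ∧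
          |Torus.iterPartialDeriv l (θ₁ t) x| ≤ N := by
  have hU : UniqueDiffOn ℝ (Ico (0 : ℝ) T₁) := uniqueDiffOn_Ico 0 T₁
  obtain ⟨cρ, hcρ, hρ⟩ := exists_pos_le_of_isSmoothSpaceTimeOn hE.smooth_density hE.density_pos hT'
  obtain ⟨cθ, hcθ, hθ⟩ := exists_pos_le_of_isSmoothSpaceTimeOn hE.smooth_temperature hE.temperature_pos hT'
  -- the finite family of iterated derivatives of orders `≤ 3`
  let ι := Σ n : Fin 4, (Fin n → Fin 3)
  obtain ⟨Kρ, hKρ0, hKρ⟩ := exists_forall_norm_le_on_slab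
    (f := fun k : ι => fun t => Torus.iterPartialDeriv (List.ofFn k.2) (ρ₁ t))
    (fun k => hE.smooth_density.iterPartialDeriv hU _) hT'
  obtain ⟨Ku, hKu0, hKu⟩ := exists_forall_norm_le_on_slab
    (f := fun k : ι => fun t => Torus.iterPartialDeriv (List.ofFn k.2) (u₁ t))
    (fun k => hE.smooth_velocity.iterPartialDeriv hU _) hT'
  obtain ⟨Kθ, hKθ0, hKθ⟩ := exists_forall_norm_le_on_slab
    (f := fun k : ι => fun t => Torus.iterPartialDeriv (List.ofFn k.2) (θ₁ t))
    (fun k => hE.smooth_temperature.iterPartialDeriv hU _) hT'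
  refine ⟨max 1 (Kρ + Ku + Kθ), min cρ cθ, le_max_left _ _, lt_min hcρ hcθ, fun t ht x => ⟨?_, ?_, ?_⟩⟩
  · exact (min_le_left _ _).trans (hρ t ht x)
  · exact (min_le_right _ _).trans (hθ t ht x)
  · intro l hl
    have hn : l.length < 4 := by omega
    let k : ι := ⟨⟨l.length, hn⟩, l.get⟩
    have e : List.ofFn k.2 = l := List.ofFn_get l
    have h1 := hKρ k t ht x
    have h2 := hKu k t ht x
    have h3 := hKθ k t ht x
    simp only [e, Real.norm_eq_abs] at h1 h2 h3
    refine ⟨h1.trans ?_, h2.trans ?_, h3.trans ?_⟩ <;>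
      linarith [le_max_right 1 (Kρ + Ku + Kθ)]

end Helpers

/-! ## §2 The bootstrap: layer 4 from the level-0 estimate and the three analytic inputs -/

section Bootstrap

set_option maxHeartbeats 800000 in
/-- **Layer 4 of Kato's Thm III for the hard-sphere Euler family — the fixed-horizon a-priori
stability estimate — from the level-0 estimate and the three analytic inputs.** Given
(L0) the `σ`-uniform level-0 relative-energy stability (`hsEuler_twoEos_level0_stability`, sibling
file), (4a) smallness interpolation on `𝕋³` (an `L²`-small `H³`-bounded smooth function is
`C¹`-small), (4b) the `σ`-uniform homogeneous `H³` energy inequality in a state box, and (4c) the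
data bound for the derivative energy: under the equation-of-state hypothesis, for every ideal-gas
reference solution on `[0, T₁)`, every `0 < T' < T₁` and `ε > 0` there are `k = 3`, `δ > 0`,
`M > 0` such that for `0 < σ < δ` and smooth positive data `δ`-close in `C³` to the reference data,
EVERY classical `σ`-solution with these data on `[0, T)`, `T ≤ T'`, obeys `M⁻¹ ≤ ρ, θ ≤ M`,
`‖u‖ ≤ M`, `|∂ᵢ(ρ, u, θ)| ≤ M` and is `ε`-close to the reference pointwise on `[0, T) × 𝕋³` —
the hypothesis `hstab` of `hsEuler_continuousDependence_of_localTheory`. Proof: the continuity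
principle `HsEulerCalc.bootstrap_of_continuousOn` on `S₀ = Σ sup |V - V₁|`, `S₁ = Σ sup |∂(V - V₁)|`;
inside the bootstrap the difference is `L²`-small by (L0), the `σ`-solution is `H³`-bounded by
(4b)+(4c) (rate from the `C¹` bound `‖V₁‖_{C¹} + 1`), hence the difference is `H³`-bounded (the
reference is smooth) and `C¹`-small by (4a). [cite: Kato1975, Thm III] [cite: Majda1984, Ch. 2 §2.1 Thm 2.2] -/
theorem stabilityEstimate_of_level0
    (hL0 : ∀ η₀ : ℝ, 0 < η₀ → ∀ F : ℝ → ℝ, AnalyticOnNhd ℝ F (Ioo (-η₀) η₀) →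
      EqOn hsExcessFreeEnergy F (Ico 0 η₀) →
      ∀ M Λ : ℝ, 1 ≤ M → 1 ≤ Λ → ∃ ηQ K₁ K₂ K₃ : ℝ, 0 < ηQ ∧ 0 ≤ K₁ ∧ 0 ≤ K₂ ∧ 0 ≤ K₃ ∧
        ∀ σ : ℝ, 0 < σ → σ ≤ 1 → ∀ T : ℝ, 0 < T →
        ∀ (ρ θ ρ₁ θ₁ : ℝ → T3 → ℝ) (u u₁ : ℝ → T3 → V3),
          IsHardSphereEulerSolution σ T ρ u θ → IsHardSphereEulerSolution 0 T ρ₁ u₁ θ₁ →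
          (∀ t ∈ Ico 0 T, ∀ x, M⁻¹ ≤ ρ t x ∧ ρ t x ≤ M ∧ M⁻¹ ≤ θ t x ∧ θ t x ≤ M ∧
              M⁻¹ ≤ ρ₁ t x ∧ ρ₁ t x ≤ M ∧ M⁻¹ ≤ θ₁ t x ∧ θ₁ t x ≤ M ∧ ρ t x * σ ^ 3 ≤ ηQ ∧
              ∀ i : Fin 3, |Torus.partialDeriv i (ρ t) x| ≤ Λ ∧ ‖Torus.partialDeriv i (u t) x‖ ≤ Λ ∧
                |Torus.partialDeriv i (θ t) x| ≤ Λ ∧ |Torus.partialDeriv i (ρ₁ t) x| ≤ Λ ∧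
                ‖Torus.partialDeriv i (u₁ t) x‖ ≤ Λ ∧ |Torus.partialDeriv i (θ₁ t) x| ≤ Λ) →
          ∀ t ∈ Ico 0 T,
            ∫ x, ((ρ t x - ρ₁ t x) ^ 2 + ‖u t x - u₁ t x‖ ^ 2 + (θ t x - θ₁ t x) ^ 2) ≤
              K₁ * Real.exp (K₂ * t) *
                ((∫ x, ((ρ 0 x - ρ₁ 0 x) ^ 2 + ‖u 0 x - u₁ 0 x‖ ^ 2 + (θ 0 x - θ₁ 0 x) ^ 2)) +
                  K₃ * (σ ^ 3 * t) ^ 2))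
    (hS : ∀ E ε : ℝ, 0 < ε → ∃ δ : ℝ, 0 < δ ∧ ∀ f : T3 → ℝ, Torus.IsSmooth f →
      (∫ x, f x ^ 2) ≤ δ →
      (∀ i : Fin 3, (∫ x, Torus.partialDeriv i f x ^ 2) ≤ E) →
      (∀ i j : Fin 3, (∫ x, Torus.partialDeriv i (Torus.partialDeriv j f) x ^ 2) ≤ E) →
      (∀ i j l : Fin 3, (∫ x, Torus.partialDeriv i (Torus.partialDeriv j (Torus.partialDeriv l f)) x ^ 2) ≤ E) →
      ∀ x, |f x| ≤ ε ∧ ∀ i : Fin 3, |Torus.partialDeriv i f x| ≤ ε)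
    (hH : ∀ η₀ : ℝ, 0 < η₀ → ∀ F : ℝ → ℝ, AnalyticOnNhd ℝ F (Ioo (-η₀) η₀) →
      EqOn hsExcessFreeEnergy F (Ico 0 η₀) →
      ∀ M Λ : ℝ, 1 ≤ M → 1 ≤ Λ → ∃ ηP C κ : ℝ, 0 < ηP ∧ 1 ≤ C ∧ 0 ≤ κ ∧
        ∀ σ : ℝ, 0 < σ → ∀ T : ℝ, 0 < T →
        ∀ (ρ θ : ℝ → T3 → ℝ) (u : ℝ → T3 → V3), IsHardSphereEulerSolution σ T ρ u θ →
        (∀ t ∈ Ico 0 T, ∀ x, M⁻¹ ≤ ρ t x ∧ ρ t x ≤ M ∧ M⁻¹ ≤ θ t x ∧ θ t x ≤ M ∧ ‖u t x‖ ≤ Λ ∧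
            ρ t x * σ ^ 3 ≤ ηP ∧
            ∀ i : Fin 3, |Torus.partialDeriv i (ρ t) x| ≤ Λ ∧ ‖Torus.partialDeriv i (u t) x‖ ≤ Λ ∧
              |Torus.partialDeriv i (θ t) x| ≤ Λ) →
        ∀ t ∈ Ico 0 T,
          derivLevelEnergy ρ u θ 3 t ≤ C * Real.exp (κ * t) * derivLevelEnergy ρ u θ 3 0)
    (hD : ∀ (ρ θ : ℝ → T3 → ℝ) (u : ℝ → T3 → V3) (t B : ℝ), 0 ≤ B →
      Torus.IsSmooth (ρ t) → Torus.IsSmooth (θ t) → Torus.IsSmooth (u t) →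
      (∀ w : List (Fin 3), 1 ≤ w.length → w.length ≤ 3 → ∀ x,
          |Torus.iterPartialDeriv w (ρ t) x| ≤ B ∧ ‖Torus.iterPartialDeriv w (u t) x‖ ≤ B ∧
            |Torus.iterPartialDeriv w (θ t) x| ≤ B) →
      derivLevelEnergy ρ u θ 3 t ≤ 200 * B ^ 2) :
    ∀ η₀ : ℝ, 0 < η₀ → ∀ F : ℝ → ℝ, AnalyticOnNhd ℝ F (Ioo (-η₀) η₀) →
      EqOn hsExcessFreeEnergy F (Ico 0 η₀) →
      ∀ (T₁ : ℝ) (ρ₁ θ₁ : ℝ → T3 → ℝ) (u₁ : ℝ → T3 → V3), IsHardSphereEulerSolution 0 T₁ ρ₁ u₁ θ₁ →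
        ∀ T' : ℝ, 0 < T' → T' < T₁ → ∀ ε : ℝ, 0 < ε →
        ∃ k : ℕ, ∃ δ M : ℝ, 0 < δ ∧ 0 < M ∧ ∀ σ : ℝ, 0 < σ → σ < δ →
          ∀ (ρ₀ θ₀ : T3 → ℝ) (u₀ : T3 → V3),
            Torus.IsSmooth ρ₀ → Torus.IsSmooth θ₀ → Torus.IsSmooth u₀ →
            (∀ x, 0 < ρ₀ x) → (∀ x, 0 < θ₀ x) →
            (∀ n : ℕ, n ≤ k → ∀ y : EuclideanSpace ℝ (Fin 3),
              ‖iteratedFDeriv ℝ n (Torus.lift fun x => ρ₀ x - ρ₁ 0 x) y‖ ≤ δ) →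
            (∀ n : ℕ, n ≤ k → ∀ y : EuclideanSpace ℝ (Fin 3),
              ‖iteratedFDeriv ℝ n (Torus.lift fun x => θ₀ x - θ₁ 0 x) y‖ ≤ δ) →
            (∀ n : ℕ, n ≤ k → ∀ y : EuclideanSpace ℝ (Fin 3),
              ‖iteratedFDeriv ℝ n (Torus.lift fun x => u₀ x - u₁ 0 x) y‖ ≤ δ) →
            ∀ T : ℝ, T ≤ T' → ∀ (ρ θ : ℝ → T3 → ℝ) (u : ℝ → T3 → V3),
              IsHardSphereEulerSolution σ T ρ u θ → ρ 0 = ρ₀ → u 0 = u₀ → θ 0 = θ₀ →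
              ∀ t ∈ Ico 0 T, ∀ x,
                (M⁻¹ ≤ ρ t x ∧ ρ t x ≤ M ∧ M⁻¹ ≤ θ t x ∧ θ t x ≤ M ∧ ‖u t x‖ ≤ M ∧
                  ∀ i : Fin 3, ‖Torus.partialDeriv i (u t) x‖ ≤ M ∧
                    |Torus.partialDeriv i (ρ t) x| ≤ M ∧ |Torus.partialDeriv i (θ t) x| ≤ M) ∧
                (|ρ t x - ρ₁ t x| < ε ∧ ‖u t x - u₁ t x‖ < ε ∧ |θ t x - θ₁ t x| < ε) := by
  intro η₀ hη₀ F hF hEq T₁ ρ₁ θ₁ u₁ hE₁ T' hT' hT'₁ ε hε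
  -- Step 1: the reference on `[0, T']`
  obtain ⟨N, m₁, hN, hm₁, href⟩ := exists_reference_bounds hE₁ hT'₁
  have hN0 : 0 < N := one_pos.trans_le hN
  -- Step 2: the constants
  set b : ℝ := min 1 (m₁ / 2) with hb
  have hb0 : 0 < b := lt_min one_pos (half_pos hm₁)
  have hb1 : b ≤ 1 := min_le_left _ _
  have hbm : b ≤ m₁ / 2 := min_le_right _ _
  set β₀ : ℝ := min b ε / 2 with hβ₀
  have hβ₀0 : 0 < β₀ := by rw [hβ₀]; exact half_pos (lt_min hb0 hε)
  have hβ₀b : 2 * β₀ ≤ b := by rw [hβ₀]; linarith only [min_le_left b ε]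
  have hβ₀ε : β₀ < ε := by rw [hβ₀]; linarith only [min_le_right b ε, hε]
  set Mst : ℝ := max (N + 1) (2 / m₁) with hMst
  have hMst1 : 1 ≤ Mst := le_trans (by linarith only [hN]) (le_max_left _ _)
  have hMst0 : 0 < Mst := one_pos.trans_le hMst1
  have hNM : N + 1 ≤ Mst := le_max_left _ _
  have hMi : Mst⁻¹ ≤ m₁ / 2 := by
    have h2 : 2 / m₁ ≤ Mst := le_max_right _ _
    have h3 : Mst⁻¹ ≤ (2 / m₁)⁻¹ := by rw [inv_le_inv₀ hMst0 (by positivity)]; exact h2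
    rwa [inv_div] at h3
  set Λst : ℝ := N + 1 with hΛst
  have hΛst1 : 1 ≤ Λst := by rw [hΛst]; linarith only [hN]
  obtain ⟨ηP, CH, κ, hηP, hCH, hκ, HH⟩ := hH η₀ hη₀ F hF hEq Mst Λst hMst1 hΛst1
  obtain ⟨ηQ, K₁, K₂, K₃, hηQ, hK₁, hK₂, hK₃, HL⟩ := hL0 η₀ hη₀ F hF hEq Mst Λst hMst1 hΛst1
  set Estar : ℝ := CH * Real.exp (κ * T') * (200 * (N + 1) ^ 2) with hEstar
  have hEstar0 : 0 ≤ Estar := by rw [hEstar]; exact mul_nonneg (mul_nonneg (zero_le_one.trans hCH) (Real.exp_pos _).le) (by positivity)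
  set Eflat : ℝ := 2 * Estar + 2 * N ^ 2 with hEflat
  set ε₁ : ℝ := min β₀ (1 / 2) / 60 with hε₁
  have hε₁0 : 0 < ε₁ := by rw [hε₁]; exact div_pos (lt_min hβ₀0 one_half_pos) (by norm_num)
  have hε₁β : 5 * ε₁ ≤ β₀ := by
    rw [hε₁]; linarith only [min_le_left β₀ (1 / 2), hβ₀0]
  have hε₁h : 15 * ε₁ ≤ 1 / 2 := by
    rw [hε₁]; linarith only [min_le_right β₀ (1 / 2)]
  obtain ⟨δ₄, hδ₄, HS⟩ := hS Eflat ε₁ hε₁0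
  set Q : ℝ := K₁ * Real.exp (K₂ * T') * (3 + K₃ * T' ^ 2) with hQ
  have hQ0 : 0 ≤ Q := by positivity
  set ηm : ℝ := min ηP ηQ with hηm
  have hηm0 : 0 < ηm := lt_min hηP hηQ
  set δ : ℝ := min (min (β₀ / 3) (1 / 18)) (min (δ₄ / (Q + 1)) (ηm / (N + 1))) with hδ
  have hδ0 : 0 < δ := lt_min (lt_min (by positivity) (by norm_num)) (lt_min (by positivity) (by positivity))
  have hδ18 : δ ≤ 1 / 18 := (min_le_left _ _).trans (min_le_right _ _)
  have hδ1 : δ ≤ 1 := hδ18.trans (by norm_num)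
  have hδβ : 3 * δ ≤ β₀ := by
    have hh : δ ≤ β₀ / 3 := (min_le_left _ _).trans (min_le_left _ _)
    linarith only [hh]
  have hδQ : δ ≤ δ₄ / (Q + 1) := (min_le_right _ _).trans (min_le_left _ _)
  have hδη : δ ≤ ηm / (N + 1) := (min_le_right _ _).trans (min_le_right _ _)
  set Mout : ℝ := max Mst (N + 1) with hMout
  have hMout0 : 0 < Mout := hMst0.trans_le (le_max_left _ _)
  refine ⟨3, δ, Mout, hδ0, hMout0, ?_⟩
  intro σ hσ hσδ ρ₀ θ₀ u₀ hρ₀s hθ₀s hu₀s hρ₀p hθ₀p hdρ hdθ hdu T hTT' ρ θ u hE hρ0 hu0 hθ0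
  -- empty horizons are trivial
  rcases le_or_gt T 0 with hTnp | hTpos
  · intro t ht; exact absurd (ht.1.trans_lt ht.2) (not_lt.2 hTnp)
  have hU : UniqueDiffOn ℝ (Ico (0 : ℝ) T) := uniqueDiffOn_Ico 0 T
  have h0T : (0 : ℝ) ∈ Ico 0 T := ⟨le_rfl, hTpos⟩
  -- facts about `σ`
  have hσ1 : σ ≤ 1 := hσδ.le.trans hδ1
  have hσ3 : σ ^ 3 ≤ σ := by
    have h := pow_le_pow_of_le_one hσ.le hσ1 (show 1 ≤ 3 by norm_num)
    rwa [pow_one] at h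
  have hσ3δ : σ ^ 3 ≤ δ := hσ3.trans hσδ.le
  have hσ30 : 0 ≤ σ ^ 3 := by positivity
  -- the reference restricted to `[0, T)`, `T ≤ T' < T₁`
  have hE₁T : IsHardSphereEulerSolution 0 T ρ₁ u₁ θ₁ := hE₁.restrict (hTT'.trans hT'₁.le)
  have hrefT : ∀ s ∈ Ico 0 T, ∀ x, m₁ ≤ ρ₁ s x ∧ m₁ ≤ θ₁ s x ∧
      ∀ l : List (Fin 3), l.length ≤ 3 →
        |Torus.iterPartialDeriv l (ρ₁ s) x| ≤ N ∧ ‖Torus.iterPartialDeriv l (u₁ s) x‖ ≤ N ∧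
          |Torus.iterPartialDeriv l (θ₁ s) x| ≤ N :=
    fun s hs x => href s ⟨hs.1, hs.2.le.trans hTT'⟩ x
  -- the difference fields
  set dρ : ℝ → T3 → ℝ := fun s y => ρ s y - ρ₁ s y with hdρdef
  set dθ : ℝ → T3 → ℝ := fun s y => θ s y - θ₁ s y with hdθdef
  set du : ℝ → T3 → V3 := fun s y => u s y - u₁ s y with hdudef
  have hα : Torus.IsSmoothSpaceTimeOn (Ico 0 T) dρ := hE.smooth_density.sub hE₁T.smooth_density
  have hβ : Torus.IsSmoothSpaceTimeOn (Ico 0 T) dθ := hE.smooth_temperature.sub hE₁T.smooth_temperature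
  have hw : Torus.IsSmoothSpaceTimeOn (Ico 0 T) du := hE.smooth_velocity.sub hE₁T.smooth_velocity
  have hαi : ∀ i, Torus.IsSmoothSpaceTimeOn (Ico 0 T) (fun s => Torus.partialDeriv i (dρ s)) :=
    fun i => hα.partialDeriv hU i
  have hβi : ∀ i, Torus.IsSmoothSpaceTimeOn (Ico 0 T) (fun s => Torus.partialDeriv i (dθ s)) :=
    fun i => hβ.partialDeriv hU i
  have hwi : ∀ i, Torus.IsSmoothSpaceTimeOn (Ico 0 T) (fun s => Torus.partialDeriv i (du s)) :=
    fun i => hw.partialDeriv hU i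
  -- smooth slices and the decomposition `V = V₁ + (V - V₁)`
  have hρs : ∀ s ∈ Ico 0 T, Torus.IsSmooth (ρ s) := fun s hs => hE.smooth_density.isSmooth_slice hs
  have hθs : ∀ s ∈ Ico 0 T, Torus.IsSmooth (θ s) := fun s hs => hE.smooth_temperature.isSmooth_slice hs
  have hus : ∀ s ∈ Ico 0 T, Torus.IsSmooth (u s) := fun s hs => hE.smooth_velocity.isSmooth_slice hs
  have hρ₁s : ∀ s ∈ Ico 0 T, Torus.IsSmooth (ρ₁ s) := fun s hs => hE₁T.smooth_density.isSmooth_slice hs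
  have hθ₁s : ∀ s ∈ Ico 0 T, Torus.IsSmooth (θ₁ s) := fun s hs => hE₁T.smooth_temperature.isSmooth_slice hs
  have hu₁s : ∀ s ∈ Ico 0 T, Torus.IsSmooth (u₁ s) := fun s hs => hE₁T.smooth_velocity.isSmooth_slice hs
  have hdρs : ∀ s ∈ Ico 0 T, Torus.IsSmooth (dρ s) := fun s hs => hα.isSmooth_slice hs
  have hdθs : ∀ s ∈ Ico 0 T, Torus.IsSmooth (dθ s) := fun s hs => hβ.isSmooth_slice hs
  have hdus : ∀ s ∈ Ico 0 T, Torus.IsSmooth (du s) := fun s hs => hw.isSmooth_slice hs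
  have hdecρ : ∀ s ∈ Ico 0 T, ∀ l : List (Fin 3), ∀ x,
      Torus.iterPartialDeriv l (ρ s) x = Torus.iterPartialDeriv l (ρ₁ s) x + Torus.iterPartialDeriv l (dρ s) x := by
    intro s hs l x
    have hfun : ρ s = fun y => ρ₁ s y + dρ s y := by funext y; simp only [hdρdef]; ring
    rw [hfun, Torus.iterPartialDeriv_add (hρ₁s s hs) (hdρs s hs) l]
  have hdecθ : ∀ s ∈ Ico 0 T, ∀ l : List (Fin 3), ∀ x,
      Torus.iterPartialDeriv l (θ s) x = Torus.iterPartialDeriv l (θ₁ s) x + Torus.iterPartialDeriv l (dθ s) x := by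
    intro s hs l x
    have hfun : θ s = fun y => θ₁ s y + dθ s y := by funext y; simp only [hdθdef]; ring
    rw [hfun, Torus.iterPartialDeriv_add (hθ₁s s hs) (hdθs s hs) l]
  have hdecu : ∀ s ∈ Ico 0 T, ∀ l : List (Fin 3), ∀ x,
      Torus.iterPartialDeriv l (u s) x = Torus.iterPartialDeriv l (u₁ s) x + Torus.iterPartialDeriv l (du s) x := by
    intro s hs l x
    have hfun : u s = fun y => u₁ s y + du s y := by funext y; simp only [hdudef]; abel
    rw [hfun, Torus.iterPartialDeriv_add (hu₁s s hs) (hdus s hs) l]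
  -- the data: `δ`-closeness in `C³` controls the words of length `≤ 3` of the difference at `t = 0`
  have hdρ0 : dρ 0 = fun x => ρ₀ x - ρ₁ 0 x := by funext x; simp only [hdρdef, hρ0]
  have hdθ0 : dθ 0 = fun x => θ₀ x - θ₁ 0 x := by funext x; simp only [hdθdef, hθ0]
  have hdu0 : du 0 = fun x => u₀ x - u₁ 0 x := by funext x; simp only [hdudef, hu0]
  have hdata : ∀ l : List (Fin 3), l.length ≤ 3 → ∀ x,
      |Torus.iterPartialDeriv l (dρ 0) x| ≤ δ ∧ ‖Torus.iterPartialDeriv l (du 0) x‖ ≤ δ ∧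
        |Torus.iterPartialDeriv l (dθ 0) x| ≤ δ := by
    intro l hl x
    refine ⟨?_, ?_, ?_⟩
    · have h := torus_norm_iterPartialDeriv_le_of_lift_bound (hdρs 0 h0T) (fun y => by
        rw [hdρ0]; exact hdρ l.length hl y) l rfl x
      rwa [Real.norm_eq_abs] at h
    · exact torus_norm_iterPartialDeriv_le_of_lift_bound (hdus 0 h0T) (fun y => by
        rw [hdu0]; exact hdu l.length hl y) l rfl x
    · have h := torus_norm_iterPartialDeriv_le_of_lift_bound (hdθs 0 h0T) (fun y => by
        rw [hdθ0]; exact hdθ l.length hl y) l rfl x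
      rwa [Real.norm_eq_abs] at h
  -- `D₃` of the σ-solution at `t = 0` (4c with `B = N + 1`)
  have hD0 : derivLevelEnergy ρ u θ 3 0 ≤ 200 * (N + 1) ^ 2 := by
    refine hD ρ θ u 0 (N + 1) (by linarith only [hN]) (hρs 0 h0T) (hθs 0 h0T) (hus 0 h0T) ?_
    intro w hw1 hw3 x
    obtain ⟨h1, h2, h3⟩ := (hrefT 0 h0T x).2.2 w hw3
    obtain ⟨d1, d2, d3⟩ := hdata w hw3 x
    refine ⟨?_, ?_, ?_⟩
    · rw [hdecρ 0 h0T w x]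
      exact (abs_add_le _ _).trans (by linarith only [h1, d1, hδ1])
    · rw [hdecu 0 h0T w x]
      exact (norm_add_le _ _).trans (by linarith only [h2, d2, hδ1])
    · rw [hdecθ 0 h0T w x]
      exact (abs_add_le _ _).trans (by linarith only [h3, d3, hδ1])
  -- the a-priori bounds along the σ-solution from smallness of the difference (pointwise)
  have hapr : ∀ s ∈ Ico 0 T, ∀ x, |dρ s x| ≤ b → |dθ s x| ≤ b → ‖du s x‖ ≤ 1 →
      (∀ i, |Torus.partialDeriv i (dρ s) x| ≤ 1 ∧ ‖Torus.partialDeriv i (du s) x‖ ≤ 1 ∧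
        |Torus.partialDeriv i (dθ s) x| ≤ 1) →
      (Mst⁻¹ ≤ ρ s x ∧ ρ s x ≤ Mst ∧ Mst⁻¹ ≤ θ s x ∧ θ s x ≤ Mst ∧
        Mst⁻¹ ≤ ρ₁ s x ∧ ρ₁ s x ≤ Mst ∧ Mst⁻¹ ≤ θ₁ s x ∧ θ₁ s x ≤ Mst ∧ ‖u s x‖ ≤ Λst ∧
        ρ s x * σ ^ 3 ≤ ηm ∧
        ∀ i : Fin 3, |Torus.partialDeriv i (ρ s) x| ≤ Λst ∧ ‖Torus.partialDeriv i (u s) x‖ ≤ Λst ∧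
          |Torus.partialDeriv i (θ s) x| ≤ Λst ∧ |Torus.partialDeriv i (ρ₁ s) x| ≤ Λst ∧
          ‖Torus.partialDeriv i (u₁ s) x‖ ≤ Λst ∧ |Torus.partialDeriv i (θ₁ s) x| ≤ Λst) := by
    intro s hs x h1 h2 h3 h4
    obtain ⟨hρ₁m, hθ₁m, hl⟩ := hrefT s hs x
    obtain ⟨r0, u0', t0⟩ := hl [] (by simp)
    simp only [Torus.iterPartialDeriv_nil] at r0 u0' t0
    have hρ₁N : ρ₁ s x ≤ N := (le_abs_self _).trans r0
    have hθ₁N : θ₁ s x ≤ N := (le_abs_self _).trans t0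
    have eρ : ρ s x = ρ₁ s x + dρ s x := by simp only [hdρdef]; ring
    have eθ : θ s x = θ₁ s x + dθ s x := by simp only [hdθdef]; ring
    have eu : u s x = u₁ s x + du s x := by simp only [hdudef]; abel
    have hdρb := abs_le.1 h1
    have hdθb := abs_le.1 h2
    have hρlo : Mst⁻¹ ≤ ρ s x := by rw [eρ]; linarith only [hMi, hbm, hdρb.1, hρ₁m]
    have hρhi : ρ s x ≤ Mst := by rw [eρ]; linarith only [hNM, hb1, hdρb.2, hρ₁N]
    have hθlo : Mst⁻¹ ≤ θ s x := by rw [eθ]; linarith only [hMi, hbm, hdθb.1, hθ₁m]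
    have hθhi : θ s x ≤ Mst := by rw [eθ]; linarith only [hNM, hb1, hdθb.2, hθ₁N]
    have hρ₁lo : Mst⁻¹ ≤ ρ₁ s x := by linarith only [hMi, hρ₁m, hm₁]
    have hθ₁lo : Mst⁻¹ ≤ θ₁ s x := by linarith only [hMi, hθ₁m, hm₁]
    have hunorm : ‖u s x‖ ≤ Λst := by
      rw [eu, hΛst]; exact (norm_add_le _ _).trans (add_le_add u0' h3)
    have hpack : ρ s x * σ ^ 3 ≤ ηm := by
      have hρN1 : ρ s x ≤ N + 1 := by rw [eρ]; linarith only [hρ₁N, hdρb.2, hb1]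
      have h5 : ρ s x * σ ^ 3 ≤ (N + 1) * δ := mul_le_mul hρN1 hσ3δ hσ30 (by linarith only [hN])
      have h6 : (N + 1) * δ ≤ ηm := by
        have := mul_le_mul_of_nonneg_left hδη (show (0:ℝ) ≤ N + 1 by linarith only [hN])
        rwa [mul_div_cancel₀ _ (show (N + 1 : ℝ) ≠ 0 by linarith only [hN])] at this
      exact h5.trans h6
    refine ⟨hρlo, hρhi, hθlo, hθhi, hρ₁lo, hρ₁N.trans (by linarith only [hNM]), hθ₁lo,
      hθ₁N.trans (by linarith only [hNM]), hunorm, hpack, fun i => ?_⟩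
    obtain ⟨r1, u1', t1⟩ := hl [i] (by simp)
    obtain ⟨g1, g2, g3⟩ := h4 i
    have e1 := hdecρ s hs [i] x
    have e2 := hdecu s hs [i] x
    have e3 := hdecθ s hs [i] x
    simp only [Torus.iterPartialDeriv_cons, Torus.iterPartialDeriv_nil] at r1 u1' t1 e1 e2 e3
    refine ⟨?_, ?_, ?_, r1.trans (by linarith only [hΛst]), u1'.trans (by linarith only [hΛst]),
      t1.trans (by linarith only [hΛst])⟩
    · rw [e1, hΛst]; exact (abs_add_le _ _).trans (add_le_add r1 g1)
    · rw [e2, hΛst]; exact (norm_add_le _ _).trans (add_le_add u1' g2)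
    · rw [e3, hΛst]; exact (abs_add_le _ _).trans (add_le_add t1 g3)
  -- sup norms of the difference and of its first derivatives
  obtain ⟨cρ0, leρ0, supρ0⟩ := shadow_sup_continuous hα
  obtain ⟨cθ0, leθ0, supθ0⟩ := shadow_sup_continuous hβ
  obtain ⟨cu0, leu0, supu0⟩ := shadow_sup_continuous_vec hw
  have cρ1 := fun i => (shadow_sup_continuous (hαi i)).1
  have leρ1 := fun i => (shadow_sup_continuous (hαi i)).2.1
  have supρ1 := fun i => (shadow_sup_continuous (hαi i)).2.2
  have cθ1 := fun i => (shadow_sup_continuous (hβi i)).1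
  have leθ1 := fun i => (shadow_sup_continuous (hβi i)).2.1
  have supθ1 := fun i => (shadow_sup_continuous (hβi i)).2.2
  have cu1 := fun i => (shadow_sup_continuous_vec (hwi i)).1
  have leu1 := fun i => (shadow_sup_continuous_vec (hwi i)).2.1
  have supu1 := fun i => (shadow_sup_continuous_vec (hwi i)).2.2
  set S₀ : ℝ → ℝ := fun s => (eSupNorm (dρ s)).toReal + (eSupNorm (dθ s)).toReal + (eSupNorm (du s)).toReal
    with hS₀
  set S₁ : ℝ → ℝ := fun s => ∑ i, ((eSupNorm (Torus.partialDeriv i (dρ s))).toReal +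
      (eSupNorm (Torus.partialDeriv i (dθ s))).toReal + (eSupNorm (Torus.partialDeriv i (du s))).toReal) with hS₁
  have hS₀c : ContinuousOn S₀ (Ico 0 T) := (cρ0.add cθ0).add cu0
  have hS₁c : ContinuousOn S₁ (Ico 0 T) :=
    continuousOn_finsetSum _ fun i _ => ((cρ1 i).add (cθ1 i)).add (cu1 i)
  have hnn : ∀ {X : Type} (f : X → ℝ), 0 ≤ (eSupNorm f).toReal := fun f => ENNReal.toReal_nonneg
  have hnnv : ∀ {X : Type} (f : X → V3), 0 ≤ (eSupNorm f).toReal := fun f => ENNReal.toReal_nonneg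
  -- pointwise read-out of the sup norms
  have hread : ∀ s ∈ Ico 0 T, ∀ A B : ℝ, S₀ s ≤ A → S₁ s ≤ B → ∀ x,
      |dρ s x| ≤ A ∧ |dθ s x| ≤ A ∧ ‖du s x‖ ≤ A ∧
      ∀ i, |Torus.partialDeriv i (dρ s) x| ≤ B ∧ ‖Torus.partialDeriv i (du s) x‖ ≤ B ∧
        |Torus.partialDeriv i (dθ s) x| ≤ B := by
    intro s hs A B hA hB x
    have h1 := leρ0 s hs x
    have h2 := leθ0 s hs x
    have h3 := leu0 s hs x
    have n1 := hnn (dρ s); have n2 := hnn (dθ s); have n3 := hnnv (du s)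
    have hS₀s : S₀ s = (eSupNorm (dρ s)).toReal + (eSupNorm (dθ s)).toReal + (eSupNorm (du s)).toReal := rfl
    refine ⟨by linarith, by linarith, by linarith, fun i => ?_⟩
    have g1 := leρ1 i s hs x
    have g2 := leθ1 i s hs x
    have g3 := leu1 i s hs x
    have hterm : (eSupNorm (Torus.partialDeriv i (dρ s))).toReal + (eSupNorm (Torus.partialDeriv i (dθ s))).toReal +
        (eSupNorm (Torus.partialDeriv i (du s))).toReal ≤ S₁ s :=
      Finset.single_le_sum (f := fun i => (eSupNorm (Torus.partialDeriv i (dρ s))).toReal +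
        (eSupNorm (Torus.partialDeriv i (dθ s))).toReal + (eSupNorm (Torus.partialDeriv i (du s))).toReal)
        (fun j _ => add_nonneg (add_nonneg (hnn _) (hnn _)) (hnnv _)) (Finset.mem_univ i)
    have m1 := hnn (Torus.partialDeriv i (dρ s)); have m2 := hnn (Torus.partialDeriv i (dθ s))
    have m3 := hnnv (Torus.partialDeriv i (du s))
    exact ⟨by linarith, by linarith, by linarith⟩
  -- the smallness mechanism: an `L²`-small, `H³`-bounded difference of smooth functions is `C¹`-small (4a)
  have hHS : ∀ (f g g₁ : T3 → ℝ), Torus.IsSmooth f → Torus.IsSmooth g → Torus.IsSmooth g₁ →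
      (∀ y, g y = f y + g₁ y) → (∫ y, f y ^ 2) ≤ δ₄ →
      (∀ l : List (Fin 3), 1 ≤ l.length → l.length ≤ 3 →
        (∫ y, Torus.iterPartialDeriv l g y ^ 2) ≤ Estar ∧ ∀ y, |Torus.iterPartialDeriv l g₁ y| ≤ N) →
      ∀ x, |f x| ≤ ε₁ ∧ ∀ i, |Torus.partialDeriv i f x| ≤ ε₁ := by
    intro f g g₁ hf hg hg₁ hfg hf2 hword
    have hw : ∀ l : List (Fin 3), 1 ≤ l.length → l.length ≤ 3 →
        (∫ y, Torus.iterPartialDeriv l f y ^ 2) ≤ Eflat := by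
      intro l hl1 hl3
      obtain ⟨hgE, hg₁N⟩ := hword l hl1 hl3
      have hgfun : g = fun y => f y + g₁ y := funext hfg
      have hdec : ∀ y, Torus.iterPartialDeriv l f y = Torus.iterPartialDeriv l g y - Torus.iterPartialDeriv l g₁ y := by
        intro y
        have h := congrFun (by rw [hgfun]; exact Torus.iterPartialDeriv_add hf hg₁ l :
          Torus.iterPartialDeriv l g = fun y => Torus.iterPartialDeriv l f y + Torus.iterPartialDeriv l g₁ y) y
        linarith only [h]
      have hpt : ∀ y, Torus.iterPartialDeriv l f y ^ 2 ≤ 2 * Torus.iterPartialDeriv l g y ^ 2 + 2 * N ^ 2 := by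
        intro y
        rw [hdec y]
        have hb := abs_le.1 (hg₁N y)
        nlinarith [sq_nonneg (Torus.iterPartialDeriv l g y + Torus.iterPartialDeriv l g₁ y), hb.1, hb.2,
          sq_nonneg (Torus.iterPartialDeriv l g₁ y), sq_abs (Torus.iterPartialDeriv l g₁ y),
          abs_nonneg (Torus.iterPartialDeriv l g₁ y)]
      have hFc : Continuous fun y => Torus.iterPartialDeriv l g y ^ 2 := (hg.iterPartialDeriv l).continuous.pow 2
      have h2F : Integrable (fun y => 2 * Torus.iterPartialDeriv l g y ^ 2) :=
        (continuous_const.mul hFc).integrable_unitAddTorus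
      have hcg : Continuous fun y => 2 * Torus.iterPartialDeriv l g y ^ 2 + 2 * N ^ 2 :=
        (continuous_const.mul hFc).add continuous_const
      have hfF : Integrable (fun y => Torus.iterPartialDeriv l f y ^ 2) :=
        ((hf.iterPartialDeriv l).continuous.pow 2).integrable_unitAddTorus
      have hmono := integral_mono hfF hcg.integrable_unitAddTorus hpt
      have heq : ∫ y, (2 * Torus.iterPartialDeriv l g y ^ 2 + 2 * N ^ 2) =
          2 * (∫ y, Torus.iterPartialDeriv l g y ^ 2) + 2 * N ^ 2 := by
        rw [integral_add h2F (integrable_const _), integral_const_mul 2 (fun y => Torus.iterPartialDeriv l g y ^ 2),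
          integral_const, probReal_univ, one_smul]
      rw [heq] at hmono
      have hEflat : Eflat = 2 * Estar + 2 * N ^ 2 := rfl
      linarith only [hmono, hgE, hEflat]
    intro x
    exact HS f hf hf2 (fun i => hw [i] (by simp) (by simp)) (fun i j => hw [i, j] (by simp) (by simp))
      (fun i j l => hw [i, j, l] (by simp) (by simp)) x
  -- the data: the monitored quantities start below the thresholds
  have hinit : S₀ 0 ≤ β₀ ∧ S₁ 0 ≤ 1 / 2 := by
    have hx0 : ∀ x, |dρ 0 x| ≤ δ ∧ |dθ 0 x| ≤ δ ∧ ‖du 0 x‖ ≤ δ ∧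
        ∀ i, |Torus.partialDeriv i (dρ 0) x| ≤ δ ∧ ‖Torus.partialDeriv i (du 0) x‖ ≤ δ ∧
          |Torus.partialDeriv i (dθ 0) x| ≤ δ := by
      intro x
      obtain ⟨d1, d2, d3⟩ := hdata [] (by simp) x
      simp only [Torus.iterPartialDeriv_nil] at d1 d2 d3
      refine ⟨d1, d3, d2, fun i => ?_⟩
      obtain ⟨e1, e2, e3⟩ := hdata [i] (by simp) x
      simp only [Torus.iterPartialDeriv_cons, Torus.iterPartialDeriv_nil] at e1 e2 e3
      exact ⟨e1, e2, e3⟩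
    have a1 := supρ0 0 δ hδ0.le fun x => (hx0 x).1
    have a2 := supθ0 0 δ hδ0.le fun x => (hx0 x).2.1
    have a3 := supu0 0 δ hδ0.le fun x => (hx0 x).2.2.1
    have hi : ∀ i, (eSupNorm (Torus.partialDeriv i (dρ 0))).toReal + (eSupNorm (Torus.partialDeriv i (dθ 0))).toReal +
        (eSupNorm (Torus.partialDeriv i (du 0))).toReal ≤ 3 * δ := by
      intro i
      have b1 := supρ1 i 0 δ hδ0.le fun x => ((hx0 x).2.2.2 i).1
      have b2 := supθ1 i 0 δ hδ0.le fun x => ((hx0 x).2.2.2 i).2.2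
      have b3 := supu1 i 0 δ hδ0.le fun x => ((hx0 x).2.2.2 i).2.1
      linarith only [b1, b2, b3]
    have h := Finset.sum_le_sum fun i (_ : i ∈ (Finset.univ : Finset (Fin 3))) => hi i
    simp only [Finset.sum_const, Finset.card_univ, Fintype.card_fin, nsmul_eq_mul, Nat.cast_ofNat] at h
    refine ⟨?_, ?_⟩
    · show (eSupNorm (dρ 0)).toReal + (eSupNorm (dθ 0)).toReal + (eSupNorm (du 0)).toReal ≤ β₀
      linarith only [a1, a2, a3, hδβ]
    · show (∑ i, ((eSupNorm (Torus.partialDeriv i (dρ 0))).toReal + (eSupNorm (Torus.partialDeriv i (dθ 0))).toReal +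
          (eSupNorm (Torus.partialDeriv i (du 0))).toReal)) ≤ 1 / 2
      linarith only [h, hδ18]
  -- the bootstrap step: under the doubled bounds on `[0, t]`, the sharp bounds at `t`
  have hstep : ∀ t ∈ Ico 0 T, (∀ s ∈ Icc 0 t, S₀ s ≤ 2 * β₀ ∧ S₁ s ≤ 2 * (1 / 2)) → S₀ t ≤ β₀ ∧ S₁ t ≤ 1 / 2 := by
    intro t ht hyp
    -- the sharp bounds at `s < t`, then continuity
    have hsharp : ∀ s ∈ Ico 0 t, S₀ s ≤ β₀ ∧ S₁ s ≤ 1 / 2 := by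
      intro s hs
      have ht0 : 0 < t := hs.1.trans_lt hs.2
      have hsT : s ∈ Ico 0 T := ⟨hs.1, hs.2.trans ht.2⟩
      -- a-priori bounds on `[0, t)`
      have hb2 : ∀ s' ∈ Ico 0 t, ∀ x, |dρ s' x| ≤ b ∧ |dθ s' x| ≤ b ∧ ‖du s' x‖ ≤ 1 ∧
          (∀ i, |Torus.partialDeriv i (dρ s') x| ≤ 1 ∧ ‖Torus.partialDeriv i (du s') x‖ ≤ 1 ∧
            |Torus.partialDeriv i (dθ s') x| ≤ 1) := by
        intro s' hs' x
        obtain ⟨a1, a2⟩ := hyp s' ⟨hs'.1, hs'.2.le⟩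
        obtain ⟨r1, r2, r3, r4⟩ := hread s' ⟨hs'.1, hs'.2.trans ht.2⟩ (2 * β₀) 1 a1 (by linarith only [a2]) x
        exact ⟨r1.trans hβ₀b, r2.trans hβ₀b, r3.trans (hβ₀b.trans hb1), r4⟩
      have haprt : ∀ s' ∈ Ico 0 t, ∀ x, _ := fun s' hs' x =>
        hapr s' ⟨hs'.1, hs'.2.trans ht.2⟩ x (hb2 s' hs' x).1 (hb2 s' hs' x).2.1 (hb2 s' hs' x).2.2.1 (hb2 s' hs' x).2.2.2
      have hEt : IsHardSphereEulerSolution σ t ρ u θ := hE.restrict ht.2.le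
      have hE₁t : IsHardSphereEulerSolution 0 t ρ₁ u₁ θ₁ := hE₁T.restrict ht.2.le
      -- (4b)+(4c): `D₃ ≤ E*` on `[0, t)`
      have hD3 : ∀ s' ∈ Ico 0 t, derivLevelEnergy ρ u θ 3 s' ≤ Estar := by
        intro s' hs'
        have h := HH σ hσ t ht0 ρ θ u hEt (fun s'' hs'' x => by
          obtain ⟨b1, b2, b3, b4, -, -, -, -, b9, b10, b11⟩ := haprt s'' hs'' x
          exact ⟨b1, b2, b3, b4, b9, b10.trans (min_le_left _ _), fun i => ⟨(b11 i).1, (b11 i).2.1, (b11 i).2.2.1⟩⟩) s' hs'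
        have hexp : Real.exp (κ * s') ≤ Real.exp (κ * T') :=
          Real.exp_le_exp.2 (mul_le_mul_of_nonneg_left (hs'.2.le.trans (ht.2.le.trans hTT')) hκ)
        have hD00 : 0 ≤ derivLevelEnergy ρ u θ 3 0 := Finset.sum_nonneg fun n _ =>
          Finset.sum_nonneg fun w _ => wordEnergy_nonneg _ _
        have hCH0 : 0 ≤ CH := zero_le_one.trans hCH
        calc derivLevelEnergy ρ u θ 3 s' ≤ CH * Real.exp (κ * s') * derivLevelEnergy ρ u θ 3 0 := h
          _ ≤ CH * Real.exp (κ * T') * (200 * (N + 1) ^ 2) :=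
            mul_le_mul (mul_le_mul_of_nonneg_left hexp hCH0) hD0 hD00 (mul_nonneg hCH0 (Real.exp_pos _).le)
          _ = Estar := rfl
      -- (L0): the difference is `L²`-small on `[0, t)`
      have hq0 : ∫ y, ((ρ 0 y - ρ₁ 0 y) ^ 2 + ‖u 0 y - u₁ 0 y‖ ^ 2 + (θ 0 y - θ₁ 0 y) ^ 2) ≤ 3 * δ ^ 2 := by
        have hpt : ∀ y, (ρ 0 y - ρ₁ 0 y) ^ 2 + ‖u 0 y - u₁ 0 y‖ ^ 2 + (θ 0 y - θ₁ 0 y) ^ 2 ≤ 3 * δ ^ 2 := by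
          intro y
          obtain ⟨d1, d2, d3⟩ := hdata [] (by simp) y
          simp only [Torus.iterPartialDeriv_nil] at d1 d2 d3
          have e1 : ρ 0 y - ρ₁ 0 y = dρ 0 y := rfl
          have e2 : u 0 y - u₁ 0 y = du 0 y := rfl
          have e3 : θ 0 y - θ₁ 0 y = dθ 0 y := rfl
          rw [e1, e2, e3]
          have q1 := abs_le.1 d1; have q3 := abs_le.1 d3
          nlinarith [norm_nonneg (du 0 y), q1.1, q1.2, q3.1, q3.2, d2]
        have hc : Continuous fun y => (ρ 0 y - ρ₁ 0 y) ^ 2 + ‖u 0 y - u₁ 0 y‖ ^ 2 + (θ 0 y - θ₁ 0 y) ^ 2 :=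
          (((hdρs 0 h0T).continuous.pow 2).add (((hdus 0 h0T).continuous.norm).pow 2)).add
            ((hdθs 0 h0T).continuous.pow 2)
        have h := integral_mono hc.integrable_unitAddTorus (integrable_const (3 * δ ^ 2)) hpt
        rwa [integral_const, probReal_univ, one_smul] at h
      have hL2 : ∀ s' ∈ Ico 0 t, ∫ y, ((ρ s' y - ρ₁ s' y) ^ 2 + ‖u s' y - u₁ s' y‖ ^ 2 + (θ s' y - θ₁ s' y) ^ 2) ≤ δ₄ := by
        intro s' hs'
        have h := HL σ hσ hσ1 t ht0 ρ θ ρ₁ θ₁ u u₁ hEt hE₁t (fun s'' hs'' x => by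
          obtain ⟨b1, b2, b3, b4, b5, b6, b7, b8, -, b10, b11⟩ := haprt s'' hs'' x
          exact ⟨b1, b2, b3, b4, b5, b6, b7, b8, b10.trans (min_le_right _ _), b11⟩) s' hs'
        have hs'T : s' ≤ T' := hs'.2.le.trans (ht.2.le.trans hTT')
        have hexp : Real.exp (K₂ * s') ≤ Real.exp (K₂ * T') := Real.exp_le_exp.2 (mul_le_mul_of_nonneg_left hs'T hK₂)
        have hst : (σ ^ 3 * s') ^ 2 ≤ δ ^ 2 * T' ^ 2 := by
          rw [← mul_pow]
          exact pow_le_pow_left₀ (mul_nonneg hσ30 hs'.1) (mul_le_mul hσ3δ hs'T hs'.1 hδ0.le) 2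
        have hδsq : δ ^ 2 ≤ δ := by nlinarith only [hδ0, hδ1]
        have hin : (∫ y, ((ρ 0 y - ρ₁ 0 y) ^ 2 + ‖u 0 y - u₁ 0 y‖ ^ 2 + (θ 0 y - θ₁ 0 y) ^ 2)) + K₃ * (σ ^ 3 * s') ^ 2 ≤
            (3 + K₃ * T' ^ 2) * δ := by
          have h1 : K₃ * (σ ^ 3 * s') ^ 2 ≤ K₃ * (δ ^ 2 * T' ^ 2) := mul_le_mul_of_nonneg_left hst hK₃
          have h2 : K₃ * (δ ^ 2 * T' ^ 2) ≤ K₃ * (δ * T' ^ 2) :=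
            mul_le_mul_of_nonneg_left (mul_le_mul_of_nonneg_right hδsq (sq_nonneg _)) hK₃
          linarith only [hq0, h1, h2, hδsq]
        have hin0 : 0 ≤ (∫ y, ((ρ 0 y - ρ₁ 0 y) ^ 2 + ‖u 0 y - u₁ 0 y‖ ^ 2 + (θ 0 y - θ₁ 0 y) ^ 2)) + K₃ * (σ ^ 3 * s') ^ 2 :=
          add_nonneg (integral_nonneg fun y => by positivity) (by positivity)
        have hQδ : Q * δ ≤ δ₄ := by
          have h1 : Q * δ ≤ Q * (δ₄ / (Q + 1)) := mul_le_mul_of_nonneg_left hδQ hQ0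
          have h2 : Q * (δ₄ / (Q + 1)) ≤ δ₄ := by
            rw [mul_div_assoc']
            rw [div_le_iff₀ (by positivity)]
            nlinarith only [hQ0, hδ₄]
          exact h1.trans h2
        calc _ ≤ K₁ * Real.exp (K₂ * s') * ((∫ y, ((ρ 0 y - ρ₁ 0 y) ^ 2 + ‖u 0 y - u₁ 0 y‖ ^ 2 + (θ 0 y - θ₁ 0 y) ^ 2)) +
              K₃ * (σ ^ 3 * s') ^ 2) := h
          _ ≤ K₁ * Real.exp (K₂ * T') * ((3 + K₃ * T' ^ 2) * δ) :=
            mul_le_mul (mul_le_mul_of_nonneg_left hexp hK₁) hin hin0 (mul_nonneg hK₁ (Real.exp_pos _).le)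
          _ = Q * δ := by simp only [hQ]; ring
          _ ≤ δ₄ := hQδ
      -- (4a) applied to the five scalar components of the difference at time `s`
      have hqs := hL2 s hs
      have hEs := hD3 s hs
      have hwordρ : ∀ l : List (Fin 3), 1 ≤ l.length → l.length ≤ 3 →
          (∫ y, Torus.iterPartialDeriv l (ρ s) y ^ 2) ≤ Estar ∧ ∀ y, |Torus.iterPartialDeriv l (ρ₁ s) y| ≤ N :=
        fun l h1 h3 => ⟨(integral_sq_iterPartialDeriv_le_derivLevelEnergy (ρ := ρ) (u := u) (ϑ := θ) h1 h3 s).1.trans hEs,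
          fun y => ((hrefT s hsT y).2.2 l h3).1⟩
      have hwordθ : ∀ l : List (Fin 3), 1 ≤ l.length → l.length ≤ 3 →
          (∫ y, Torus.iterPartialDeriv l (θ s) y ^ 2) ≤ Estar ∧ ∀ y, |Torus.iterPartialDeriv l (θ₁ s) y| ≤ N :=
        fun l h1 h3 => ⟨(integral_sq_iterPartialDeriv_le_derivLevelEnergy (ρ := ρ) (u := u) (ϑ := θ) h1 h3 s).2.2.trans hEs,
          fun y => ((hrefT s hsT y).2.2 l h3).2.2⟩
      have hwordu : ∀ k : Fin 3, ∀ l : List (Fin 3), 1 ≤ l.length → l.length ≤ 3 →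
          (∫ y, Torus.iterPartialDeriv l (fun y => u s y k) y ^ 2) ≤ Estar ∧
            ∀ y, |Torus.iterPartialDeriv l (fun y => u₁ s y k) y| ≤ N := by
        intro k l h1 h3
        refine ⟨((integral_sq_iterPartialDeriv_le_derivLevelEnergy (ρ := ρ) (u := u) (ϑ := θ) h1 h3 s).2.1 k).trans hEs,
          fun y => ?_⟩
        rw [CompressibleEuler.iterPartialDeriv_apply_coord (hu₁s s hsT) l y k]
        exact (CompressibleEuler.abs_apply_le_norm _ k).trans ((hrefT s hsT y).2.2 l h3).2.1
      have hqint : ∀ (f : T3 → ℝ), Continuous f →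
          (∀ y, f y ^ 2 ≤ (ρ s y - ρ₁ s y) ^ 2 + ‖u s y - u₁ s y‖ ^ 2 + (θ s y - θ₁ s y) ^ 2) → (∫ y, f y ^ 2) ≤ δ₄ := by
        intro f hf hle
        have hc : Continuous fun y => (ρ s y - ρ₁ s y) ^ 2 + ‖u s y - u₁ s y‖ ^ 2 + (θ s y - θ₁ s y) ^ 2 :=
          (((hdρs s hsT).continuous.pow 2).add (((hdus s hsT).continuous.norm).pow 2)).add ((hdθs s hsT).continuous.pow 2)
        exact (integral_mono (hf.pow 2).integrable_unitAddTorus hc.integrable_unitAddTorus hle).trans hqs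
      have hsmallρ := hHS (dρ s) (ρ s) (ρ₁ s) (hdρs s hsT) (hρs s hsT) (hρ₁s s hsT)
        (fun y => by simp only [hdρdef]; ring)
        (hqint _ (hdρs s hsT).continuous fun y => by
          simp only [hdρdef]; linarith only [sq_nonneg ‖u s y - u₁ s y‖, sq_nonneg (θ s y - θ₁ s y)])
        hwordρ
      have hsmallθ := hHS (dθ s) (θ s) (θ₁ s) (hdθs s hsT) (hθs s hsT) (hθ₁s s hsT)
        (fun y => by simp only [hdθdef]; ring)
        (hqint _ (hdθs s hsT).continuous fun y => by
          simp only [hdθdef]; linarith only [sq_nonneg ‖u s y - u₁ s y‖, sq_nonneg (ρ s y - ρ₁ s y)])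
        hwordθ
      have hsmallu : ∀ k : Fin 3, ∀ x, |du s x k| ≤ ε₁ ∧ ∀ i, |Torus.partialDeriv i (fun y => du s y k) x| ≤ ε₁ := by
        intro k
        have hfk : Torus.IsSmooth (fun y => du s y k) := (hdus s hsT).apply k
        refine hHS (fun y => du s y k) (fun y => u s y k) (fun y => u₁ s y k) hfk ((hus s hsT).apply k)
          ((hu₁s s hsT).apply k) (fun y => by simp only [hdudef, PiLp.sub_apply]; ring)
          (hqint _ hfk.continuous fun y => ?_) (hwordu k)
        have h0 : (u s y - u₁ s y) k ^ 2 ≤ ‖u s y - u₁ s y‖ ^ 2 := by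
          rw [EuclideanSpace.real_norm_sq_eq]
          exact Finset.single_le_sum (f := fun i => (u s y - u₁ s y) i ^ 2) (fun i _ => sq_nonneg _) (Finset.mem_univ k)
        have h1 : du s y k ^ 2 ≤ ‖u s y - u₁ s y‖ ^ 2 := by simpa only [hdudef] using h0
        linarith only [h1, sq_nonneg (ρ s y - ρ₁ s y), sq_nonneg (θ s y - θ₁ s y)]
      -- read the sup norms at `s`
      have hduk : ∀ x, ‖du s x‖ ≤ 3 * ε₁ := fun x =>
        (CompressibleEuler.norm_le_sum_abs _).trans (by
          have h := Finset.sum_le_sum fun k (_ : k ∈ (Finset.univ : Finset (Fin 3))) => (hsmallu k x).1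
          simp only [Finset.sum_const, Finset.card_univ, Fintype.card_fin, nsmul_eq_mul, Nat.cast_ofNat] at h
          exact h)
      have hdukd : ∀ i x, ‖Torus.partialDeriv i (du s) x‖ ≤ 3 * ε₁ := fun i x =>
        (CompressibleEuler.norm_le_sum_abs _).trans (by
          have h := Finset.sum_le_sum fun k (_ : k ∈ (Finset.univ : Finset (Fin 3))) => by
            have e := Torus.partialDeriv_apply_coord ((hdus s hsT).isContDiff (by simp)) i x k
            have := ((hsmallu k x).2 i)
            rw [e] at this
            exact this
          simp only [Finset.sum_const, Finset.card_univ, Fintype.card_fin, nsmul_eq_mul, Nat.cast_ofNat] at h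
          exact h)
      have hs₀ : S₀ s ≤ 5 * ε₁ := by
        have a1 := supρ0 s ε₁ hε₁0.le fun x => (hsmallρ x).1
        have a2 := supθ0 s ε₁ hε₁0.le fun x => (hsmallθ x).1
        have a3 := supu0 s (3 * ε₁) (by positivity) (hduk)
        show (eSupNorm (dρ s)).toReal + (eSupNorm (dθ s)).toReal + (eSupNorm (du s)).toReal ≤ 5 * ε₁
        linarith only [a1, a2, a3]
      have hs₁ : S₁ s ≤ 15 * ε₁ := by
        have hi : ∀ i, (eSupNorm (Torus.partialDeriv i (dρ s))).toReal + (eSupNorm (Torus.partialDeriv i (dθ s))).toReal +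
            (eSupNorm (Torus.partialDeriv i (du s))).toReal ≤ 5 * ε₁ := by
          intro i
          have a1 := supρ1 i s ε₁ hε₁0.le fun x => (hsmallρ x).2 i
          have a2 := supθ1 i s ε₁ hε₁0.le fun x => (hsmallθ x).2 i
          have a3 := supu1 i s (3 * ε₁) (by positivity) (hdukd i)
          linarith only [a1, a2, a3]
        have h := Finset.sum_le_sum fun i (_ : i ∈ (Finset.univ : Finset (Fin 3))) => hi i
        simp only [Finset.sum_const, Finset.card_univ, Fintype.card_fin, nsmul_eq_mul, Nat.cast_ofNat] at h
        show (∑ i, ((eSupNorm (Torus.partialDeriv i (dρ s))).toReal + (eSupNorm (Torus.partialDeriv i (dθ s))).toReal +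
            (eSupNorm (Torus.partialDeriv i (du s))).toReal)) ≤ 15 * ε₁
        linarith only [h]
      exact ⟨hs₀.trans hε₁β, hs₁.trans hε₁h⟩
    rcases eq_or_lt_of_le ht.1 with ht0 | ht0
    · -- `t = 0`: the data
      subst ht0
      exact hinit
    · exact ⟨CompressibleEuler.le_of_forall_lt_of_continuousOn hS₀c ht ht0 fun s hs => (hsharp s hs).1,
        CompressibleEuler.le_of_forall_lt_of_continuousOn hS₁c ht ht0 fun s hs => (hsharp s hs).2⟩
  -- the continuity principle
  have hboot := bootstrap_of_continuousOn (ι := Fin 2) (T := T) (g := ![S₀, S₁])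
    (b := ![fun _ => β₀, fun _ => (1 / 2 : ℝ)])
    (Fin.forall_fin_two.2 ⟨hS₀c, hS₁c⟩)
    (Fin.forall_fin_two.2 ⟨continuousOn_const, continuousOn_const⟩)
    (Fin.forall_fin_two.2 ⟨fun _ _ => hβ₀0, fun _ _ => one_half_pos⟩)
    (Fin.forall_fin_two.2 ⟨hinit.1, hinit.2⟩)
    (fun t ht H => Fin.forall_fin_two.2 (hstep t ht fun s hs => ⟨H 0 s hs, H 1 s hs⟩))
  have hfin : ∀ t ∈ Ico 0 T, S₀ t ≤ β₀ ∧ S₁ t ≤ 1 / 2 := fun t ht => ⟨hboot 0 t ht, hboot 1 t ht⟩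
  -- conclusion
  intro t ht x
  obtain ⟨q1, q2⟩ := hfin t ht
  obtain ⟨r1, r2, r3, r4⟩ := hread t ht β₀ (1 / 2) q1 q2 x
  have hβb : β₀ ≤ b := by linarith only [hβ₀b, hβ₀0]
  obtain ⟨b1, b2, b3, b4, -, -, -, -, b9, -, b11⟩ := hapr t ht x (r1.trans hβb) (r2.trans hβb)
    (r3.trans (hβb.trans hb1)) fun i => ⟨((r4 i).1).trans (by norm_num), ((r4 i).2.1).trans (by norm_num),
      ((r4 i).2.2).trans (by norm_num)⟩
  have hMM : Mst ≤ Mout := le_max_left _ _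
  have hΛM : Λst ≤ Mout := le_max_right _ _
  have hinvM : Mout⁻¹ ≤ Mst⁻¹ := by rw [inv_le_inv₀ hMout0 hMst0]; exact hMM
  refine ⟨⟨hinvM.trans b1, b2.trans hMM, hinvM.trans b3, b4.trans hMM, b9.trans hΛM, fun i =>
    ⟨(b11 i).2.1.trans hΛM, (b11 i).1.trans hΛM, (b11 i).2.2.1.trans hΛM⟩⟩, ?_, ?_, ?_⟩
  · exact lt_of_le_of_lt r1 hβ₀ε
  · exact lt_of_le_of_lt r3 hβ₀ε
  · exact lt_of_le_of_lt r2 hβ₀ε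

end Bootstrap

end HsEulerStability

end Literature.MathematicalPhysics.KineticTheory

end
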